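import Literature.AnabelianGeometry.EtaleTheta.LogDivisorModelConstantField
import Literature.AnabelianGeometry.EtaleTheta.LogDivisorModelTateTower

/-!
# [EtTh] §3 p.72 / Def. 3.3 (iii): the constant-field side of the Tate tower skeleton — `N = G`,
# the Galois-correspondence binder, and triviality of `D₀ → D^cnst` on the tower

S. Mochizuki, *The étale theta function …*, Publ. RIMS **45** (2009) [MochizukiEtTh2009], §3: the functor
`D₀ → D^cnst = B(Spec K)⁰` determined by `Π^tp_X ↠ G_K` (p.72), Def. 3.3 (iii) (p.73), Thm. 3.7 (iii) (p.79 l.−6 –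
p.80 l.2: "the natural action of `Aut_C(A)` on `O^▷(A)` and `O^×(A)` factors through `Aut_{D^cnst}(A^cnst)`")
[cite: MochizukiEtTh2009, Def 3.3 p.73].

PROOF-ONLY sequel (abc-iut cell, W6 seat d058 lineage; 0 defs) to the class (b) model
`LogDivisorModel.TateTower` (`LogDivisorModelTateTower.lean`: the combinatorial skeleton of the universal
combinatorial covering of a Tate curve, `G = ℤ` translating the chain, constants `⟨ϖ⟩`) and to the
constant-field functor `GaloisAction.constQuot / cnstFunctor` and binder `GaloisAction.ConstGaloisLaw` of
`LogDivisorModelConstantField.lean` (GAP row G-w6d058-2).  Recorded here — the two items deferred in the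
model file's docstring until the constant-field module was built, plus their consequence for `D^cnst`:
* `TateTower.actFn_eq_of_mem_const` / **`TateTower.constInertia_eq_top`** — the translations fix every
  constant `ϖ^c`, so `N := Ker(G → Aut(L'^×)) = G`;
* **`TateTower.constGaloisLaw`** — the Galois-correspondence binder `ConstGaloisLaw` HOLDS for the tower
  (with `n := a`): at this model the hypothesis `hGC` of `Discharge/Sec3Prop34CnstOfGaloisCovering.lean` is a
  theorem, not a binder;
* **`TateTower.subsingleton_constQuotObj`** / `subsingleton_cnstFunctor_obj` — for every CONNECTED covering
  `S` dominated by the tower, `N∖S` is one point: the constant-field functor `D₀ → D^cnst` sends every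
  connected covering of the tower to `Spec K` itself (no constant-field extension occurs along the chain of
  copies of the projective line — as it must for the universal combinatorial covering, Rmk. 3.3.1 "differ
  only by an extension of the base field");
* `TateTower.cnstFunctor_map_eq` — consequently any two covering maps between connected coverings of the
  tower have the SAME image in `D^cnst` (the image of `Aut` in `Aut_{D^cnst}(A^cnst)` is trivial, the
  degenerate case of Thm. 3.7 (iii)'s factorization).
HONEST FRAMING: statements about a combinatorial consistency witness for the typed interfaces; nothing here
bears on [IUTchIII] Cor. 3.12; no side taken; typed ≠ proved for anything else.
-/

namespace Literature.AnabelianGeometry.EtaleTheta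

open CategoryTheory

namespace LogDivisorModel

namespace TateTower

/-- Every translation of the chain fixes every constant `ϖ^c` (the shear `ϖ^c U^k ↦ ϖ^{c-kt} U^k` is the
identity on `k = 0`). [cite: MochizukiEtTh2009, Def 3.3 p.73] -/
theorem actFn_eq_of_mem_const (g : Multiplicative ℤ) {f : model.Fn} (hf : f ∈ model.const) :
    action.actFn g f = f := by
  obtain ⟨c, rfl⟩ := hf
  refine Multiplicative.toAdd.injective ?_
  change Multiplicative.toAdd (shearFn (Multiplicative.toAdd g) ((AddMonoidHom.inl ℤ ℤ).toMultiplicative c)) =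
    Multiplicative.toAdd ((AddMonoidHom.inl ℤ ℤ).toMultiplicative c)
  rw [toAdd_shearFn]
  simp [AddMonoidHom.toMultiplicative]

/-- **`N = G` for the Tate tower**: the subgroup of `G = ℤ` acting trivially on the constants is everything.
[cite: MochizukiEtTh2009, Def 3.3 p.73] -/
theorem constInertia_eq_top : action.constInertia = ⊤ := by
  rw [eq_top_iff]
  intro g _
  exact (action.mem_constInertia_iff g).2 fun f hf => actFn_eq_of_mem_const g hf

/-- Every element of `G` lies in `N`. [cite: MochizukiEtTh2009, Def 3.3 p.73] -/
theorem mem_constInertia (g : Multiplicative ℤ) : g ∈ action.constInertia := by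
  rw [constInertia_eq_top]; exact Subgroup.mem_top g

/-- **The Galois-correspondence binder `ConstGaloisLaw` (GAP G-w6d058-2) HOLDS for the Tate tower** (with
`N = G`, witness `n := a`). [cite: MochizukiEtTh2009, Thm 3.7 (iii) p.79] -/
theorem constGaloisLaw : action.ConstGaloisLaw :=
  ⟨fun H a _ => ⟨a, mem_constInertia a, by rw [inv_mul_cancel]; exact H.one_mem⟩⟩

/-- **`D₀ → D^cnst` is trivial on the tower**: for a CONNECTED covering `S` dominated by the tower, the
constant-field `G`-set `N∖S` is a single point (`= Spec K`). [cite: MochizukiEtTh2009, Def 3.3 p.73] -/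
theorem subsingleton_constQuotObj (S : Action (Type 0) (Multiplicative ℤ)) (hS : GaloisAction.isConnectedGSet S) :
    Subsingleton (action.constQuotObj S).V := by
  refine ⟨fun (p q : Quotient (action.constOrbitSetoid S)) => ?_⟩
  induction p using Quotient.ind with
  | _ s =>
  induction q using Quotient.ind with
  | _ t =>
  obtain ⟨g, hg⟩ := hS.2 s t
  exact Quotient.sound ⟨g, mem_constInertia g, hg⟩

/-- The same for the functor `cnstFunctor : D₀ → D^cnst` on the connected coverings.
[cite: MochizukiEtTh2009, Def 3.3 p.73] -/
theorem subsingleton_cnstFunctor_obj (Y : (GaloisAction.isConnectedGSet (G := Multiplicative ℤ)).FullSubcategory) :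
    Subsingleton (action.cnstFunctor.obj Y).V :=
  subsingleton_constQuotObj Y.obj Y.property

/-- Consequently ANY two covering maps between connected coverings of the tower have the same image in
`D^cnst` (the image of the automorphism group of a covering in `Aut_{D^cnst}(A^cnst)` is trivial — the
degenerate case of Thm. 3.7 (iii)'s factorization). [cite: MochizukiEtTh2009, Thm 3.7 (iii) p.79] -/
theorem cnstFunctor_map_eq {Y Y' : (GaloisAction.isConnectedGSet (G := Multiplicative ℤ)).FullSubcategory} (g g' : Y ⟶ Y') :
    action.cnstFunctor.map g = action.cnstFunctor.map g' := by
  rw [action.cnstFunctor_map_eq_iff]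
  intro s
  obtain ⟨n, hn⟩ := Y'.property.2 (g.hom.hom s) (g'.hom.hom s)
  exact ⟨n, mem_constInertia n, hn⟩

/-- In particular every endomorphism of a connected covering of the tower maps to the identity of its
constant field. [cite: MochizukiEtTh2009, Thm 3.7 (iii) p.79] -/
theorem cnstFunctor_map_eq_id {Y : (GaloisAction.isConnectedGSet (G := Multiplicative ℤ)).FullSubcategory} (g : Y ⟶ Y) :
    action.cnstFunctor.map g = 𝟙 _ := by
  rw [← action.cnstFunctor.map_id]
  exact cnstFunctor_map_eq g (𝟙 Y)

end TateTower

end LogDivisorModel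

end Literature.AnabelianGeometry.EtaleTheta
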